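import Mathlib
import HarnessLib
import Summits.NavierStokesRegularity.NavierStokesRegularity.Theorems.TaylorModelRungThreeCertificateReadoutVDiagWin

/-!
# Crux K1b-DR (stmt-NavierStokesRegularity-23954), line `taylor-model` — v3 WINDOWED read-outs: DIAGNOSTIC of the POINCARÉ-CORRECTED
# base landing «(R9p)» (ns-tm-g4 g6; computable defs only — a MEASUREMENT for the replay driver, not a test of record)

Why: the windowed base landing (R9w) evaluates the landing of the LEVEL-0 BOX (hull `H⁰ = x ± |B|·rp` at node `S−1` pushed through the
last sub-step) over the level-0 window; its smear is `rate_j · (u0hi − u0lo + δt_set)` where `δt_set` is the box's own extent ALONG THE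
FLOW in time units (a validated-integration enclosure is typically a needle along the flow).  The first windowed replay (engine-1
j321721) shows the level-0 box straddling the section by `±3.2e-5` in `σf` at stage 0 (`δt_set ≈ 1.6e-10`) where `rate_0 ≈ 2.4e12`
per unit time (tm-g4 LEVEL0-RATES table) — so at the early stages (R9w) cannot pass whatever the window, unless the re-emission
shrinks the base enclosure below `≈ 1e-14` time units.  The robust cure is to read the base landing THROUGH THE SECTION (Poincaré map),
whose derivative `Dland·Psec·DΦ` kills the flow direction:

  (R9p)  `|ℓ_l(land y_c) − ctr_l| + |ℓ_l·Dland(y₁)·Psec(y₁)·A·d| + β_l ≤ rad_l − s_l`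
  for the CENTRE trajectory's crossing state `y_c` (a point trajectory: no set), every crossing state `y₁ ∈ Z¹`, in-step kernel `A`
  (level-1 window) and level-0 displacement `|d| ≤ ρ⁰ := radLW 0` (mean value along the segment from `x_{S−1}` to the true base state).

THIS FILE ONLY MEASURES IT: `CertTables.diagR9p` returns per face `l < nF` the triple `(cenC_l, mv_l, slack_l)` with
`cenC_l := mag(W_l·landBox(Z⁰c) − ctr_l)` (`Z⁰c` = centre-only in-step box over the level-0 window: `Zl U0 u0hi (pointBox x)`),
`mv_l := (Σ_c mag((W_l·[DL(Z¹)]·[PS(Z¹)]·[MinW])_c) · ρ⁰_c)↑`, `slack_l := rad_l↓ − s_l↑ − β_l↑`, and `diagR9pOK` the Boolean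
`∀ l, cenC_l + mv_l ≤ slack_l`; `CertTablesV.checkReadoutStageWinDiagP'/…DiagPOK'` per stage (checkpoint form, `ρ⁰ = radLW 0 (startNode (S−1))`).
If these come out `true` where (R9w) is structurally `false`, the K-side builds (R9p) as a test of record (new semantic clause +
G-side mean-value proof along the lines of `landingDeriv_ofVW`; plan in certificates/WINDOWED-READOUTS-23954.md §R9p).

HONEST FRAMING: replay instrumentation for the MODEL certificate №23954 (rung TL-M3); nothing here is a statement about the
Navier–Stokes equations, and nothing is asserted.
-/

-- the sub-problem namespace repeats the summit name by design (D-0017)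
set_option linter.dupNamespace false

namespace Summit.NavierStokesRegularity.NavierStokesRegularity.Theorems.TaylorModelCert

namespace ROInWin

variable {K : Type} [Field K] (T : CertTables K) (rw : ROInWin)

/-- Centre-only level-0 in-step box over the level-0 window (hull := the point `x`). [folklore] -/
def Z0c : Array IntervalD := rw.Zl T ⟨rw.u0lo, rw.u0hi⟩ rw.u0hi (IntervalD.pointBoxA T.n rw.base.x)

/-- The Poincaré-corrected displacement kernel box `[DL(Z¹)]·[PS(Z¹)]·[MinW]`. [folklore] -/
def M0 : Array (Array IntervalD) :=
  mulII T.n rw.base.prec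
    (mulII T.n rw.base.prec (T.dlBox rw.base.prec rw.base.LvB rw.base.tv (rw.Z1 T)) (T.psBox rw.base.prec rw.base.Wσ (rw.Fw T)))
    (rw.MinW T)

end ROInWin

namespace CertTables

variable {K : Type} [Field K]

/-- **(R9p) numbers per face** `l < nF`: `(cenC_l, mv_l, slack_l)` (see the module docstring); `ρ0` = the level-0 hull radii at
node `S−1`. [folklore] -/
def diagR9p (T : CertTables K) (rw : ROInWin) (ρ0 : Array Dyad) : Array (Dyad × Dyad × Dyad) :=
  let ri := rw.base
  let LB0 := T.landBox ri.prec ri.LvB ri.tv (rw.Z0c T)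
  let M := rw.M0 T
  Array.ofFn fun l : Fin ri.nF =>
    let Wl := IntervalD.lget ri.WJ l
    let cenC := IntervalD.mag (IntervalD.subR ri.prec
      (IntervalD.rangeSumR ri.prec (fun c => IntervalD.mulR ri.prec (IntervalD.aget Wl c) (IntervalD.aget LB0 c)) T.n)
      (IntervalD.aget ri.ctrB l))
    let C := IntervalD.covMulIM T.n ri.prec Wl M
    let mv := (IntervalD.rangeSumR ri.prec (fun c => IntervalD.mulR ri.prec
      (IntervalD.ofDyad (IntervalD.mag (IntervalD.aget C c))) (IntervalD.ofDyad (dget ρ0 c))) T.n).hi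
    let slack := Dyad.sub (Dyad.sub (IntervalD.aget ri.radB l).lo (IntervalD.aget ri.sB l).hi) (IntervalD.aget ri.βB l).hi
    (cenC, mv, slack)

/-- **(R9p) as a Boolean** (measurement only): structural `landOK` of both boxes, `psOK`, and `cenC_l + mv_l ≤ slack_l` for all faces.
[folklore] -/
def diagR9pOK (T : CertTables K) (rw : ROInWin) (ρ0 : Array Dyad) : Bool :=
  let ri := rw.base
  T.landOK (rw.Z0c T) && T.landOK (rw.Z1 T) && T.psOK ri.prec ri.Wσ (rw.Fw T) &&
  (T.diagR9p rw ρ0).all fun t => Dyad.ble (Dyad.add t.1 t.2.1) t.2.2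

end CertTables

namespace CertTablesV

variable (TV : CertTablesV) (kitOf : ℕ → CoreKit) (wT : ℕ → Array Dyad) (A : ReadoutAux QS2) (WV : WindowsV)

/-- Level-0 hull radii at node `S−1` of stage `j` (checkpoint form). [folklore] -/
def rho0' (j : ℕ) : Array Dyad :=
  TV.radLW kitOf wT j 0 ((TV.ctxOfW kitOf wT j).startNode ((TV.base.stage j).S - 1))

/-- Per-stage (R9p) numbers (checkpoint form). [folklore] -/
def checkReadoutStageWinDiagP' (j : ℕ) : Array (Dyad × Dyad × Dyad) :=
  TV.base.diagR9p (TV.roInWin' kitOf wT A WV j) (TV.rho0' kitOf wT j)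

/-- Per-stage (R9p) Boolean (measurement only; checkpoint form). [folklore] -/
def checkReadoutStageWinDiagPOK' (j : ℕ) : Bool :=
  TV.base.diagR9pOK (TV.roInWin' kitOf wT A WV j) (TV.rho0' kitOf wT j)

end CertTablesV

end Summit.NavierStokesRegularity.NavierStokesRegularity.Theorems.TaylorModelCert
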